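import Mathlib
import HarnessLib
import Summits.HubbardSuperconductivity.HubbardSuperconductivity.Theorems.LiebTwinNoOnsiteODLROPseudospinCeiling

/-!
# Crux `NoOnsiteODLRO` (stmt-HubbardSuperconductivity-0933) — the on-site pair DENSITY ceiling along
# admissible sequences

The pseudospin ceiling (`pseudospinOnsiteCeiling_filling`) read in the crux's own vocabulary: for `U > 0`,
`δ ∈ (0, 1/2)`, an admissible `(N_L, S^z = 0)`-sector ground-state sequence `ψ_L` of `hubbardTorus 2 L 1 U`
(`N_L = 2⌊(1-δ)L²/2⌋`, `‖ψ_L‖ = 1`) and the pair window `w_L = U - (E(N_L,0) - E(N_L-2,0))`: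

* `onsiteDensity_le_of_window` — at every even side `L ≥ 3` with `κ ≤ w_L`, `κ > 0`:
  `S_L / L⁴ ≤ 4(1-δ)(δ + 4/L²)/κ`, `S_L = Re⟨ψ_L, P_sᴴP_s ψ_L⟩`;
* `onsiteDensity_eventually_le_of_window` — if `κ ≤ w_L` eventually along even `L` (a STRICT, `L`-uniform
  pair window), then for every `ε > 0`, eventually `S_L / L⁴ ≤ 4δ(1-δ)/κ + ε`.

This is the quantitative object the crux census (`Cruxes/NoOnsiteODLRO/STRATEGY-CENSUS.md`, by-products B3–B5)
recommends in place of the universal `o(L⁴)` statement: an every-ground-state on-site condensate DENSITY CEILING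
`4δ(1-δ)/κ`, closed-form in `(δ, κ)`, valid at every coupling `U ≥ 0` for which the window is strict. It does NOT
prove the crux (`∀ ε`), and cannot: free fermions already give `S_L ≍ L²`, while the ceiling is `O(L⁴)`.

Sources: S. C. Zhang, PRL 65 (1990) 120; C. N. Yang, S. C. Zhang, Mod. Phys. Lett. B 4 (1990) 759; C. N. Yang,
PRL 63 (1989) 2144; K. Kubo, T. Kishi, PRB 41 (1990) 4866 (the half-filled `χ_pair ≤ 1/U`, for comparison).
Bookkeeping only (floors and limits); no definition is introduced.
-/

noncomputable section

-- the mandated namespace `Summit.<Summit>.<Problem>.Theorems` repeats `HubbardSuperconductivity`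
-- (single-problem summit, D-0017), which the `dupNamespace` linter flags on every declaration
set_option linter.dupNamespace false

namespace Summit.HubbardSuperconductivity.HubbardSuperconductivity.Theorems.NoOnsiteODLRO.Pseudospin

open Matrix Finset
open Literature.Probability.LatticeModels Literature.MathematicalPhysics.QuantumLattice
open scoped ComplexOrder

/-! ### The route's particle number `N_L = 2⌊(1-δ)L²/2⌋` -/

/-- `(1-δ)L² - 2 ≤ N_L = 2⌊(1-δ)L²/2⌋`. [folklore] -/
theorem sub_two_le_cast_two_mul_natFloor (δ : ℝ) (L : ℕ) :
    (1 - δ) * (L : ℝ) ^ 2 - 2 ≤ ((2 * ⌊(1 - δ) * (L : ℝ) ^ 2 / 2⌋₊ : ℕ) : ℝ) := by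
  have h := Nat.lt_floor_add_one ((1 - δ) * (L : ℝ) ^ 2 / 2)
  push_cast
  linarith

/-- For `δ < 1/2` and `L ≥ 3` the route's sector is not empty of pairs: `2 ≤ N_L`. [folklore] -/
theorem two_le_two_mul_natFloor {δ : ℝ} (hδ : δ < 1 / 2) {L : ℕ} (hL : 3 ≤ L) :
    2 ≤ 2 * ⌊(1 - δ) * (L : ℝ) ^ 2 / 2⌋₊ := by
  have hL' : (3 : ℝ) ≤ (L : ℝ) := by exact_mod_cast hL
  have h1 : (1 : ℝ) ≤ (1 - δ) * (L : ℝ) ^ 2 / 2 := by nlinarith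
  have h2 : 1 ≤ ⌊(1 - δ) * (L : ℝ) ^ 2 / 2⌋₊ := by
    rw [Nat.one_le_floor_iff]
    exact h1
  omega

/-! ### The density ceiling -/

/-- **On-site pair density ceiling at one side.** For `U > 0`, `δ ∈ (0,1/2)`, an admissible
`(N_L, S^z=0)`-sector ground-state sequence `ψ` of `hubbardTorus 2 L 1 U`, and an even side `L ≥ 3` at which
the pair window dominates `κ > 0`, `κ ≤ U - (E(N_L,0) - E(N_L-2,0))`:
`Re⟨ψ_L, P_sᴴP_s ψ_L⟩ / L⁴ ≤ 4(1-δ)(δ + 4/L²)/κ`. From `pseudospinOnsiteCeiling_filling` with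
`L² - N_L + 2 ≤ δL² + 4` and `N_L ≤ (1-δ)L²`. Zhang, PRL 65 (1990) 120; crux census B3. [folklore] -/
theorem onsiteDensity_le_of_window :
    ∀ (U δ : ℝ), 0 < U → δ ∈ Set.Ioo (0 : ℝ) (1 / 2) →
      ∀ (N : ℕ → ℕ) (ψ : ∀ L, Fock (Orb (FermionTorus 2 L))),
        (∀ L, Even L → N L = 2 * ⌊(1 - δ) * (L : ℝ) ^ 2 / 2⌋₊ ∧ star (ψ L) ⬝ᵥ ψ L = 1 ∧
            IsGroundStateInSector (hubbardTorus 2 L 1 U) (N L) 0 (ψ L)) →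
        ∀ κ : ℝ, 0 < κ → ∀ (L : ℕ) [NeZero L], Even L → 3 ≤ L →
          κ ≤ U - ((hubbardTorus 2 L 1 U).minEnergyOn (szSector (Λ := FermionTorus 2 L) (N L) 0) -
              (hubbardTorus 2 L 1 U).minEnergyOn (szSector (Λ := FermionTorus 2 L) (N L - 2) 0)) →
          (expect ((pairField sWave L)ᴴ * pairField sWave L) (ψ L)).re / (L : ℝ) ^ 4 ≤
            4 * (1 - δ) * (δ + 4 / (L : ℝ) ^ 2) / κ := by
  intro U δ _ hδ N ψ hyp κ hκ L _ hLe hL3 hwin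
  obtain ⟨hN, hu, hgs⟩ := hyp L hLe
  have hLpos : (0 : ℝ) < (L : ℝ) := by exact_mod_cast Nat.pos_of_ne_zero (NeZero.ne L)
  have hL4 : (0 : ℝ) < (L : ℝ) ^ 4 := by positivity
  have hL2 : (0 : ℝ) < (L : ℝ) ^ 2 := by positivity
  -- side conditions on `N_L`
  have hN2 : 2 ≤ N L := by rw [hN]; exact two_le_two_mul_natFloor hδ.2 hL3
  have hNL : N L ≤ L ^ 2 := by rw [hN]; exact two_mul_natFloor_le_sq hδ.1.le L
  have hNup : ((N L : ℕ) : ℝ) ≤ (1 - δ) * (L : ℝ) ^ 2 := by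
    -- `N_L = 2⌊(1-δ)L²/2⌋ ≤ (1-δ)L²` (cf. `BirGroundStateAverageLRO.Negative.cast_pairNumber_le`)
    rw [hN]
    have hx : 0 ≤ (1 - δ) * (L : ℝ) ^ 2 / 2 := by
      have : 0 ≤ 1 - δ := by linarith [hδ.2]
      positivity
    have hfl := Nat.floor_le hx
    push_cast
    linarith
  have hNlow : (1 - δ) * (L : ℝ) ^ 2 - 2 ≤ ((N L : ℕ) : ℝ) := by rw [hN]; exact sub_two_le_cast_two_mul_natFloor δ L
  -- the filling form of the pseudospin ceiling, with `‖ψ_L‖ = 1`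
  have h := pseudospinOnsiteCeiling_filling hLe hL3 U hN2 hNL hgs
  rw [hu, Complex.one_re, mul_one] at h
  set S : ℝ := (expect ((pairField sWave L)ᴴ * pairField sWave L) (ψ L)).re with hS
  set w : ℝ := U - ((hubbardTorus 2 L 1 U).minEnergyOn (szSector (N L) 0) -
    (hubbardTorus 2 L 1 U).minEnergyOn (szSector (N L - 2) 0)) with hw
  have hSnn : 0 ≤ S := by
    rw [hS, PosSemidefTrace.expect_conjTranspose_mul]
    exact (Complex.nonneg_iff.mp (dotProduct_star_self_nonneg _)).1
  -- `κ S ≤ w S ≤ (L² - N + 2)·4N ≤ (δL² + 4)·4(1-δ)L²`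
  have h1 : κ * S ≤ w * S := mul_le_mul_of_nonneg_right hwin hSnn
  have h2 : ((L : ℝ) ^ 2 - (N L : ℕ) + 2) * (4 * (N L : ℕ)) ≤
      (δ * (L : ℝ) ^ 2 + 4) * (4 * ((1 - δ) * (L : ℝ) ^ 2)) := by
    have ha : (L : ℝ) ^ 2 - (N L : ℕ) + 2 ≤ δ * (L : ℝ) ^ 2 + 4 := by linarith
    have hb : (0 : ℝ) ≤ (L : ℝ) ^ 2 - (N L : ℕ) + 2 := by
      have : ((N L : ℕ) : ℝ) ≤ ((L ^ 2 : ℕ) : ℝ) := by exact_mod_cast hNL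
      push_cast at this
      linarith
    have hc : (0 : ℝ) ≤ 4 * ((N L : ℕ) : ℝ) := by positivity
    calc ((L : ℝ) ^ 2 - (N L : ℕ) + 2) * (4 * (N L : ℕ))
        ≤ (δ * (L : ℝ) ^ 2 + 4) * (4 * (N L : ℕ)) := mul_le_mul_of_nonneg_right ha hc
      _ ≤ (δ * (L : ℝ) ^ 2 + 4) * (4 * ((1 - δ) * (L : ℝ) ^ 2)) := by
          refine mul_le_mul_of_nonneg_left (by linarith) ?_
          have := hδ.1.le
          positivity
  have h3 : κ * S ≤ (δ * (L : ℝ) ^ 2 + 4) * (4 * ((1 - δ) * (L : ℝ) ^ 2)) := h1.trans (h.trans h2)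
  -- divide by `κ L⁴`
  rw [div_le_iff₀ hL4, ← sub_nonneg]
  have h4 : 4 * (1 - δ) * (δ + 4 / (L : ℝ) ^ 2) / κ * (L : ℝ) ^ 4 - S =
      ((δ * (L : ℝ) ^ 2 + 4) * (4 * ((1 - δ) * (L : ℝ) ^ 2)) - κ * S) / κ := by
    field_simp
  rw [h4]
  exact div_nonneg (by linarith) hκ.le

/-- **On-site pair density ceiling, eventual form.** For `U > 0`, `δ ∈ (0,1/2)`, an admissible sequence
`ψ` and a pair window that is eventually STRICT and `L`-uniform, `κ ≤ U - (E(N_L,0) - E(N_L-2,0))` for all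
even `L ≥ L₁` (`κ > 0`): for every `ε > 0`, eventually along even `L`,
`Re⟨ψ_L, P_sᴴP_s ψ_L⟩ / L⁴ ≤ 4δ(1-δ)/κ + ε`. The closed-form every-ground-state on-site condensate density
ceiling of the crux census (B3/B5); a ceiling, not the crux's `o(L⁴)`. Zhang, PRL 65 (1990) 120; Yang–Zhang,
Mod. Phys. Lett. B 4 (1990) 759. [folklore] -/
theorem onsiteDensity_eventually_le_of_window :
    ∀ (U δ : ℝ), 0 < U → δ ∈ Set.Ioo (0 : ℝ) (1 / 2) →
      ∀ (N : ℕ → ℕ) (ψ : ∀ L, Fock (Orb (FermionTorus 2 L))),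
        (∀ L, Even L → N L = 2 * ⌊(1 - δ) * (L : ℝ) ^ 2 / 2⌋₊ ∧ star (ψ L) ⬝ᵥ ψ L = 1 ∧
            IsGroundStateInSector (hubbardTorus 2 L 1 U) (N L) 0 (ψ L)) →
        ∀ κ : ℝ, 0 < κ → ∀ L₁ : ℕ,
          (∀ (L : ℕ) [NeZero L], Even L → L₁ ≤ L →
            κ ≤ U - ((hubbardTorus 2 L 1 U).minEnergyOn (szSector (Λ := FermionTorus 2 L) (N L) 0) -
              (hubbardTorus 2 L 1 U).minEnergyOn (szSector (Λ := FermionTorus 2 L) (N L - 2) 0))) →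
          ∀ ε : ℝ, 0 < ε → ∃ L₀ : ℕ, ∀ (L : ℕ) [NeZero L], Even L → L₀ ≤ L →
            (expect ((pairField sWave L)ᴴ * pairField sWave L) (ψ L)).re / (L : ℝ) ^ 4 ≤
              4 * δ * (1 - δ) / κ + ε := by
  intro U δ hU hδ N ψ hyp κ hκ L₁ hwin ε hε
  refine ⟨L₁ + 3 + ⌈16 * (1 - δ) / (κ * ε)⌉₊, fun L _ hLe hL => ?_⟩
  have hL3 : 3 ≤ L := by omega
  have h := onsiteDensity_le_of_window U δ hU hδ N ψ hyp κ hκ L hLe hL3 (hwin L hLe (by omega))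
  refine h.trans ?_
  -- `4(1-δ)(δ + 4/L²)/κ = 4δ(1-δ)/κ + 16(1-δ)/(κ L²) ≤ 4δ(1-δ)/κ + ε`
  have hLpos : (0 : ℝ) < (L : ℝ) := by exact_mod_cast Nat.pos_of_ne_zero (NeZero.ne L)
  have h1δ : 0 < 1 - δ := by linarith [hδ.2]
  have hceil : 16 * (1 - δ) / (κ * ε) ≤ (L : ℝ) := by
    have h1 := Nat.le_ceil (16 * (1 - δ) / (κ * ε))
    have h2 : ((⌈16 * (1 - δ) / (κ * ε)⌉₊ : ℕ) : ℝ) ≤ (L : ℝ) := by exact_mod_cast (by omega : ⌈16 * (1 - δ) / (κ * ε)⌉₊ ≤ L)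
    linarith
  have hL1 : (1 : ℝ) ≤ (L : ℝ) := by exact_mod_cast (by omega : 1 ≤ L)
  have hLsq : (L : ℝ) ≤ (L : ℝ) ^ 2 := by nlinarith
  have hkey : 16 * (1 - δ) / (κ * (L : ℝ) ^ 2) ≤ ε := by
    rw [div_le_iff₀ (by positivity)]
    rw [div_le_iff₀ (by positivity)] at hceil
    nlinarith [mul_pos hκ hε]
  have hsplit : 4 * (1 - δ) * (δ + 4 / (L : ℝ) ^ 2) / κ =
      4 * δ * (1 - δ) / κ + 16 * (1 - δ) / (κ * (L : ℝ) ^ 2) := by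
    field_simp
    ring
  rw [hsplit]
  linarith

/-- **Registered stub `stub_onsiteDensityCeilingOfWindow`** of crux `NoOnsiteODLRO`
(stmt-HubbardSuperconductivity-0933; crux-strategist by-products B3/B5, not a piece of a line composition): the
eventual on-site pair density ceiling `4δ(1-δ)/κ` under an `L`-uniform strict pair window `κ`
(`onsiteDensity_eventually_le_of_window`). Zhang, PRL 65 (1990) 120; Yang–Zhang, Mod. Phys. Lett. B 4 (1990) 759.
[folklore] -/
theorem stub_onsiteDensityCeilingOfWindow :
    ∀ (U δ : ℝ), 0 < U → δ ∈ Set.Ioo (0 : ℝ) (1 / 2) →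
      ∀ (N : ℕ → ℕ) (ψ : ∀ L, Fock (Orb (FermionTorus 2 L))),
        (∀ L, Even L → N L = 2 * ⌊(1 - δ) * (L : ℝ) ^ 2 / 2⌋₊ ∧ star (ψ L) ⬝ᵥ ψ L = 1 ∧
            IsGroundStateInSector (hubbardTorus 2 L 1 U) (N L) 0 (ψ L)) →
        ∀ κ : ℝ, 0 < κ → ∀ L₁ : ℕ,
          (∀ (L : ℕ) [NeZero L], Even L → L₁ ≤ L →
            κ ≤ U - ((hubbardTorus 2 L 1 U).minEnergyOn (szSector (Λ := FermionTorus 2 L) (N L) 0) -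
              (hubbardTorus 2 L 1 U).minEnergyOn (szSector (Λ := FermionTorus 2 L) (N L - 2) 0))) →
          ∀ ε : ℝ, 0 < ε → ∃ L₀ : ℕ, ∀ (L : ℕ) [NeZero L], Even L → L₀ ≤ L →
            (expect ((pairField sWave L)ᴴ * pairField sWave L) (ψ L)).re / (L : ℝ) ^ 4 ≤
              4 * δ * (1 - δ) / κ + ε :=
  onsiteDensity_eventually_le_of_window

end Summit.HubbardSuperconductivity.HubbardSuperconductivity.Theorems.NoOnsiteODLRO.Pseudospin

end
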